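import Literature.AlgebraicGeometry.HodgeTheory.FermatAokiSubvarietyCodimension
import HarnessLib

/-!
# Aoki's Thm. 2-1 (`claim(σ_{p,a})`): the two remaining leaves as named facts

Family `hodge`, layer `Literature/AlgebraicGeometry/HodgeTheory`; decomposition file (librarian,
fact-decompose `libsplit-37`, human 2026-08-16) for the named fact `Aoki1987_claim_pStandard` of
`FermatInductiveClaims.lean` — N. Aoki, *Some new algebraic cycles on Fermat varieties*, J. Math.
Soc. Japan 39 (1987) 385–396, THEOREM 2-1 (p. 388) with "represents ⟹ claim" (p. 386): for
`p = 2r + 1` an odd prime, `p ∣ m`, `d = m/p > 2`, `(a, d) = 1`, claim(σ_{p,a}) holds on `X^{p-1}ₘ`.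

The proof files `FermatInductiveClaimsProofs.lean` and `FermatAokiSubvarietyCodimension.lean` prove
everything of the printed argument that lives on the tree's carriers — Prop. 3-1 (i) `Y ⊂ X`,
Prop. 3-1 (dimension half) `codim Y ≥ r` pointwise, "represents ⟹ claim"
(`FermatCharacter.claim_of_supportedClass`), permutation invariance of claim(α) — and assemble the
fact from two explicit hypotheses (`Aoki1987_claim_pStandard_of_subvariety_represents`). This file
names those two hypotheses as the children of the decomposition (named facts, D-0014) and records
the assembly under the `_holds_of` name:

* `Ran1980_fermatEigenspace_le_span` — (I) for `r > 0` and `α ∈ 𝔄²ʳₘ` the eigenspace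
  `V(α) ⊆ H²ʳ(X²ʳₘ(ℂ); ℂ)` is at most a line ("it is well known that `dim V(α) = 1`", Aoki p. 385;
  Ran 1980, §1 Prop. 1.7 (i); Shioda 1979, §1) — the character decomposition of the primitive
  cohomology of the Fermat variety under `μₘⁿ⁺²/Δ`;
* `Aoki1987_thm_2_1_supportedClass` — (II) the cohomological half of Thm. 2-1: some class
  supported on `Y = Y_{c₀} ∩ X²ʳₘ` (classically `cl(Y)`, `ω_σ(Y)·\overline{ω_σ(Y)} = (-1)ʳ p^{p-2} mᵖ ≠ 0`,
  §§3–4 of the paper: the intersection numbers `Y · Yᵍ` and the inductive structure) has non-zero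
  `σ_{p,a}`-component.

* `Aoki1987_claim_pStandard_holds_of : (I) → (II) → Aoki1987_claim_pStandard` — PROVED (it is
  `Aoki1987_claim_pStandard_of_subvariety_represents`).

(I) also serves `Shioda_claim_paired` (`ShiodaClaimPairedProofs.lean`, same hypothesis `hE1`) and the
linear-subspace files (`FermatLinearSubspaceClass.lean`).

## References

* [Aoki1987] N. Aoki, J. Math. Soc. Japan 39 (1987) 385–396: p. 385 (`dim V(α) = 1`), p. 386
  ("represents"), (2.1) and Thm. 2-1 (p. 388), Prop. 3-1 (p. 389), §4.
* [Ran1980] Z. Ran, *Cycles on Fermat hypersurfaces*, Compositio Math. 42 (1980) 121–142, §1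
  Prop. 1.7 (i).
* [Shioda1979] T. Shioda, *The Hodge conjecture for Fermat varieties*, Math. Ann. 245 (1979), §1.
-/

noncomputable section

open CategoryTheory AlgebraicGeometry Finset

namespace Literature.AlgebraicGeometry.HodgeTheory

open Literature.AlgebraicGeometry.Motives Literature.AlgebraicTopology.SingularHomology

/-- **The eigenspaces `V(α)`, `α ∈ 𝔄ⁿₘ`, of the middle cohomology of the Fermat variety are at
most lines (named fact).** Aoki 1987, p. 385: "`H^n_prim(Xⁿₘ, ℂ) = ⊕_{α ∈ 𝔄ⁿₘ} V(α)` … It is well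
known that `dim V(α) = 1`"; Ran 1980, §1 Prop. 1.7 (i) (the character decomposition of the
primitive cohomology of `Xⁿₘ` under `Γ = μₘⁿ⁺²/Δ`, each admissible character occurring with
multiplicity one); Shioda 1979, §1. Rendering, on the tree's carriers and in even dimension
`n = 2r > 0`: for every admissible character `α` of `X²ʳₘ` (`FermatCharacter.IsAdmissible`: all
`αᵢ ≠ 0`, `Σ αᵢ = 0`) the eigenspace `fermatEigenspace m α (2r) ⊆ H²ʳ(X²ʳₘ(ℂ); ℂ)` is contained in
the span of a single vector (`dim ≤ 1`; the printed `= 1` is not needed downstream and not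
asserted). This is hypothesis (I) `hE1` of `Aoki1987_claim_pStandard_of_subvariety_represents` and of
`ShiodaClaimPairedProofs.lean`. Users take `(h : Ran1980_fermatEigenspace_le_span)`.
[cite: Ran1980, §1 Prop. 1.7 (i)] [cite: Aoki1987, p. 385 (dim V(α) = 1)] -/
def Ran1980_fermatEigenspace_le_span : Prop :=
  ∀ (m r : ℕ) [NeZero m] (α : Fin (2 * r + 2) → ZMod m), 0 < r →
    FermatCharacter.IsAdmissible α → ∃ v, fermatEigenspace m α (2 * r) ≤ ℂ ∙ v

/-- **Aoki 1987, Thm. 2-1 — the cohomological half: a class supported on `Y` represents `σ_{p,a}`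
(named fact).** Printed (p. 388): "THEOREM 2-1. The variety `Y` defined by (2.1)
[`x₀^{kd} + ⋯ + x_{p-1}^{kd} = 0 (1 ≤ k ≤ r)`, `x_pᵖ - εᵖ ᵈ√p · x₀x₁⋯x_{p-1} = 0`] is a subvariety of
`X^{p-1}ₘ` of codimension `r` and it represents the class `α` [= `σ_{p,a}`]. More precisely we have
`ω_α(Y)·\overline{ω_α(Y)} = (-1)ʳ p^{p-2} mᵖ`" (proof: §3 Prop. 3-1 and §4, the computation of
`ω_α(Y)` through the intersection numbers `I(Y, Yᵍ)`). Rendering (hypothesis (II) `hY` of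
`Aoki1987_claim_pStandard_of_subvariety_represents`, cycle-map-free): for `p = 2r + 1` prime,
`p ∣ m`, `d = m/p > 2`, `a : ℤ/m` with `(⟨a⟩, d) = 1`, there are a constant `c₀ ∈ ℂ` (in print
`c₀ = εᵖ ᵈ√p`) and a class `c ∈ H²ʳ(X²ʳₘ(ℂ); ℂ)` SUPPORTED ON `Y = Y_{c₀} ∩ X²ʳₘ`
(`Aoki1987.fermatAokiSection`; `c` dies on the complex points of the complement — classically any
non-zero multiple of `cl(Y)`) whose `σ_{p,a}`-component `fermatProjector m σ_{p,a} (2r) c` is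
non-zero, `σ_{p,a} = (a, a+d, …, a+(p-1)d, -pa)` in Aoki's order of coordinates
(`FermatCharacter.aokiStandard`). The codimension statement of Thm. 2-1 is NOT part of this fact
(its half `codim ≥ r` is proved: `Aoki1987.le_coheight_of_mem_fermatAokiSection`).
Users take `(h : Aoki1987_thm_2_1_supportedClass)`.
[cite: Aoki1987, Thm. 2-1 (p. 388) and §4; p. 386 (ω_α(Z) = P_α([Z]), "represents")] -/
def Aoki1987_thm_2_1_supportedClass : Prop :=
  ∀ (m r : ℕ) [NeZero m], (2 * r + 1).Prime → 2 * r + 1 ∣ m → 2 < m / (2 * r + 1) →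
    ∀ a : ZMod m, Nat.Coprime a.val (m / (2 * r + 1)) →
    ∃ (c₀ : ℂ) (c : complexBetti (fermatHypersurface (2 * r) m) (2 * r)),
      complexBetti.restrictCompl (fermatHypersurface (2 * r) m)
          (Aoki1987.fermatAokiSection m r (m / (2 * r + 1)) c₀) (2 * r) c = 0 ∧
        fermatProjector m (FermatCharacter.aokiStandard r m a) (2 * r) c ≠ 0

/-- **Decomposition of `Aoki1987_claim_pStandard`** (Aoki 1987, Thm. 2-1 ⟹ claim(σ_{p,a})): from
its two children (I) `Ran1980_fermatEigenspace_le_span` and (II) `Aoki1987_thm_2_1_supportedClass`,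
by the tree's theorem `Aoki1987_claim_pStandard_of_subvariety_represents` (Prop. 3-1,
"represents ⟹ claim", permutation invariance — all proved).
[cite: Aoki1987, Thm. 2-1 (p. 388), Prop. 3-1 (p. 389) and p. 386] -/
theorem Aoki1987_claim_pStandard_holds_of (hE1 : Ran1980_fermatEigenspace_le_span)
    (hY : Aoki1987_thm_2_1_supportedClass) : Aoki1987_claim_pStandard :=
  Aoki1987_claim_pStandard_of_subvariety_represents hE1 hY

end Literature.AlgebraicGeometry.HodgeTheory

end
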